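import Literature.Geometry.Lorentzian.InitialData
import Literature.Geometry.Lorentzian.AsymptoticFlatness
import Literature.Geometry.Lorentzian.Development
import Literature.Geometry.Lorentzian.KerrConvergence
import HarnessLib

/-!
# The admissible data class and the "settles down to Kerr black holes" predicate of the
# final state conjecture (trunk T-LORENTZ / G08, family `gr`, summit `FinalStateConjecture`)

Two interface definitions consumed by the summit statement
`Summits/FinalStateConjecture/FinalStateConjecture/Statement.lean` (D-0015 draft), written
over the sorry-free prelude (`InitialData`, `AsymptoticFlatness`, `Development`,
`KerrConvergence`) only:

* `admissibleVacuumData X` — Christodoulou's admissible class `𝓓` of initial data on the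
  connected `3`-manifold `X`: smooth `(h, k)` solving the vacuum constraints, `(X, h)` complete,
  with an asymptotically flat end which is the sole end of `X` and on which
  `h = (1 + 2M/r) δ + o₂(r⁻¹)`, `k = o₁(r⁻²)` (Dafermos–Rodnianski rates). Christodoulou, CQG 16
  (1999) A23, p. A24 ("complete, strongly asymptotically flat solutions of the vacuum
  constraints, one end"); Dafermos–Rodnianski, Clay lectures (2008/2013), App. B.2.3.
  **This is the shared home of the two verbatim-equal copies `Literature.Geometry.Lorentzian.IsAdmissibleWCCData`
  (`CosmicCensorship`) and `Literature.Geometry.Lorentzian.IsAdmissibleFinalStateData` (`Stability`)** — those files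
  record the duplication as lint debt and both currently sit behind the build-broken
  `ModelData`; the only change is the D-0014 standing-hypothesis idiom
  `∀ [D.metric.HasLeviCivita], …` around the two Levi-Civita-dependent clauses (exactly as in
  `Development.induced_k`, `VacuumDevelopment.isRicciFlat`,
  `Development.HasCompleteFutureNullInfinity`).
* `Development.SettlesToKerrFamily 𝒟 k` — clause (ii) of the final state conjecture for a
  development `𝒟 = (M, g, τ, ι, ν)`: "the exterior of `𝒟` settles down, in `Cᵏ`, to finitely
  many Kerr black holes moving apart plus radiation dispersing to Minkowski space"
  (Klainerman, C. R. Mécanique 353 (2025), §1.1.1; Coley, GRG 51 (2019), p. 14; Dafermos–Luk,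
  arXiv:1710.01722, §1.3.1; Penrose 1982, Problem 12), rendered with the hypothesis structure
  `FinalStateDecomposition` of `KerrConvergence` on the **self-determined exterior region**
  `J⁺(ι X) ∩ I⁻(charted late region)` (design note below).

## Design note: which region carries the decomposition

`FinalStateDecomposition 𝓢 𝒟oc k` takes the region `𝒟oc` as a parameter and pins it only from
above (covering clause: `𝒟oc ∖ charts ⊆ J⁻(initial slabs)`). Three renderings exist:
(a) `∃ 𝒟oc` (interim `Stability`, `Literature.GR.FinalStateConjecture k`): a witness may take
`𝒟oc = ⋃ charts`, making the covering clause vacuous, so nothing forces the charts to exhaust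
the exterior; (b) `𝒟oc = Development.futureExterior 𝒟` (interim `Sweep1`,
`FinalStateExteriorConjecture`), the ray-theoretic `J⁺(ι X) ∩ ⋃ I⁻(future-complete null rays
from X)`: intrinsic, but it equals `J⁻(𝓘⁺) ∩ J⁺(ι X)` only if black-hole interiors carry no
future-complete null rays from `X`, so it silently folds a strong-cosmic-censorship-type interior
statement into a conjecture that "makes no statement about the structure of the black hole
interior" (Dafermos–Luk, p. 10, on Conjecture 1); (c) **this file**: `𝒟oc` is existential but
required to EQUAL `J⁺(ι X) ∩ I⁻(d.charted)`, the causal future of the data hypersurface cut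
down to the chronological past of the union of the `N + 1` late chart images of the witnessing
decomposition `d` itself — the device of `Development.ExteriorConvergesTo` (`Sweep1`, gr.S05:
"the chart itself cuts out `J⁺(Σ) ∩ I⁻(Ψ(late))`") transported to `N` holes. Content of (c):
every event to the future of the data which can send a timelike signal into the asymptotic,
charted, converging region is itself charted or lies in the causal past of the initial slabs —
i.e. the charts exhaust the exterior down to the event horizons, with no interior claim and no
`𝓘⁺`. For `N = 0` and a flat chart on all of `E4` this is convergence to Minkowski space on
`J⁺(ι X) ∩ I⁻(late image)`.

## Mathlib

No Lorentzian geometry in Mathlib (see `KerrConvergence`, `InitialData`); only `Set` algebra,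
`TopologicalSpace.Opens`, `Filter.Tendsto` are used. Nothing here duplicates Mathlib.

## References

* D. Christodoulou, *On the global initial value problem and the issue of singularities*,
  Class. Quantum Grav. 16 (1999) A23–A35, p. A24.
* M. Dafermos, I. Rodnianski, *Lectures on black holes and linear waves*, Clay Math. Proc. 17
  (2013), arXiv:0811.0354, App. B.2.3.
* S. Klainerman, *The black hole stability problem*, C. R. Mécanique 353 (2025) 555–581,
  §1.1.1.
* A. A. Coley, *Mathematical general relativity*, Gen. Relativity Gravitation 51 (2019) 78,
  p. 14 (§ "The Final State Conjecture").
* M. Dafermos, J. Luk, *The interior of dynamical vacuum black holes I*, arXiv:1710.01722,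
  §1.3.1 and Conjecture 1.
* R. Penrose, *Some unsolved problems in classical general relativity* (1982), Problem 12.
-/

noncomputable section

open Set TopologicalSpace Filter
open scoped Manifold ContDiff Topology

universe u

namespace Literature.Geometry.Lorentzian

/-! ### The admissible class -/

section Admissible

variable (X : Type u) [TopologicalSpace X] [ChartedSpace E3 X] [IsManifold (𝓡 3) ∞ X]

/-- **Christodoulou's admissible class `𝓓`** of initial data for the cosmic censorship and final
state conjectures on the (connected) `3`-manifold `X`: smooth initial data sets `D = (h, k)`
which solve the vacuum constraint equations and are complete (both clauses under the standing
Levi-Civita hypothesis `[D.metric.HasLeviCivita]` of `InitialData`, bound inside as in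
`VacuumDevelopment.isRicciFlat`), and which possess an asymptotically flat end `e` that is the
*only* end of `X` (`AFEnd.IsSoleEnd`) and on which the data are strongly asymptotically flat
with some mass parameter `M`, `h = (1 + 2M/r) δ + o₂(r⁻¹)`, `k = o₁(r⁻²)`
(`AFEnd.IsStronglyAsymptoticallyFlatDR`). Christodoulou: "complete, strongly asymptotically
flat solutions of the vacuum constraints with one end" (his rates are the faster
Christodoulou–Klainerman ones, `IsStronglyAsymptoticallyFlatCK`, which imply these:
`IsStronglyAsymptoticallyFlatCK.isStronglyAsymptoticallyFlatDR`; the class here is the larger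
Dafermos–Rodnianski one, as in the interim `IsAdmissibleWCCData`/`IsAdmissibleFinalStateData`,
of which this is the shared, sorry-free-prelude copy).
[cite: Christodoulou1999, p. A24] [cite: DafermosRodnianski2013, App. B.2.3] -/
def admissibleVacuumData : Set (InitialDataSet (𝓡 3) X) :=
  {D | (∀ [D.metric.HasLeviCivita], D.IsVacuumConstraintSolution ∧ D.IsComplete) ∧
    ∃ (e : AFEnd X) (M : ℝ), e.IsSoleEnd ∧ e.IsStronglyAsymptoticallyFlatDR D M}

variable {X}

/-- Unfolding lemma for membership in the admissible class (Christodoulou, CQG 16 (1999),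
p. A24). [cite: Christodoulou1999, p. A24] -/
theorem mem_admissibleVacuumData_iff {D : InitialDataSet (𝓡 3) X} :
    D ∈ admissibleVacuumData X ↔
      (∀ [D.metric.HasLeviCivita], D.IsVacuumConstraintSolution ∧ D.IsComplete) ∧
        ∃ (e : AFEnd X) (M : ℝ), e.IsSoleEnd ∧ e.IsStronglyAsymptoticallyFlatDR D M :=
  Iff.rfl

/-- Admissible data solve the vacuum constraint equations (Christodoulou, CQG 16 (1999),
p. A24). [cite: Christodoulou1999, p. A24] -/
theorem isVacuumConstraintSolution_of_mem_admissibleVacuumData {D : InitialDataSet (𝓡 3) X}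
    [D.metric.HasLeviCivita] (hD : D ∈ admissibleVacuumData X) :
    D.IsVacuumConstraintSolution :=
  hD.1.1

/-- Admissible data are complete (Christodoulou, CQG 16 (1999), p. A24). [cite: Christodoulou1999, p. A24] -/
theorem isComplete_of_mem_admissibleVacuumData {D : InitialDataSet (𝓡 3) X}
    [D.metric.HasLeviCivita] (hD : D ∈ admissibleVacuumData X) : D.IsComplete :=
  hD.1.2

/-- Admissible data have a sole, strongly asymptotically flat end (Christodoulou, CQG 16
(1999), p. A24; Dafermos–Rodnianski 2013, App. B.2.3). [cite: Christodoulou1999, p. A24] -/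
theorem exists_isSoleEnd_of_mem_admissibleVacuumData {D : InitialDataSet (𝓡 3) X}
    (hD : D ∈ admissibleVacuumData X) :
    ∃ e : AFEnd X, e.IsSoleEnd ∧ ∃ M : ℝ, e.IsStronglyAsymptoticallyFlatDR D M := by
  obtain ⟨-, e, M, hsole, hSAF⟩ := hD
  exact ⟨e, hsole, M, hSAF⟩

end Admissible

/-! ### The charted late region of a final state decomposition -/

namespace FinalStateDecomposition

variable {𝓢 : Spacetime.{u} 4} {𝒟 : Set 𝓢.carrier} {k : ℕ}

/-- The **charted late region** of an `N`-black-hole final state decomposition `d`: the union of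
its radiation zone (image of the late flat domain) and its `N` black-hole regions (images of the
late boosted Kerr exteriors). Klainerman, C. R. Mécanique 353 (2025), §1.1.1 ("a finite number
of Kerr black holes plus a radiative decaying term"). [cite: Klainerman2025, §1.1.1] -/
def charted (d : FinalStateDecomposition 𝓢 𝒟 k) : Set 𝓢.carrier :=
  d.radiationZone ∪ ⋃ i, d.region i

/-- The charted late region lies in the region `𝒟` being decomposed (each chart is a late chart
into `𝒟`). Klainerman, C. R. Mécanique 353 (2025), §1.1.1. [cite: Klainerman2025, §1.1.1] -/
theorem charted_subset (d : FinalStateDecomposition 𝓢 𝒟 k) : d.charted ⊆ 𝒟 :=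
  union_subset d.radiationZone_subset (iUnion_subset d.region_subset)

/-- The radiation zone is part of the charted late region. [folklore] -/
theorem radiationZone_subset_charted (d : FinalStateDecomposition 𝓢 𝒟 k) :
    d.radiationZone ⊆ d.charted :=
  subset_union_left

/-- Each black-hole region is part of the charted late region. [folklore] -/
theorem region_subset_charted (d : FinalStateDecomposition 𝓢 𝒟 k) (i : Fin d.N) :
    d.region i ⊆ d.charted :=
  (subset_iUnion (fun i ↦ d.region i) i).trans subset_union_right

/-- A final state decomposition in `Cᵏ'` is one in `Cᵏ` for `k ≤ k'`, **with the same charts**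
(all `Cᵏ` sup norms are monotone in `k`, `supCkENorm_mono_right`). DHRT arXiv:2104.08222, §1
(convergence with loss of derivatives). [cite: arXiv210408222, §1] -/
def ofLE {k k' : ℕ} (d : FinalStateDecomposition 𝓢 𝒟 k') (h : k ≤ k') :
    FinalStateDecomposition 𝓢 𝒟 k where
  N := d.N
  mass := d.mass
  spin := d.spin
  mass_pos := d.mass_pos
  abs_spin_le_mass := d.abs_spin_le_mass
  motion := d.motion
  τ₀ := d.τ₀
  chart := d.chart
  isLateChart := d.isLateChart
  tendsto_truncDeviationCk i R :=
    tendsto_of_tendsto_of_tendsto_of_le_of_le tendsto_const_nhds (d.tendsto_truncDeviationCk i R)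
      (fun _ ↦ zero_le) fun _ ↦ supCkENorm_mono_right _ h _
  exists_pairwise_disjoint := d.exists_pairwise_disjoint
  excision := d.excision
  tendsto_excision_div := d.tendsto_excision_div
  flatDomain := d.flatDomain
  setOf_lt_excision_subset_flatDomain := d.setOf_lt_excision_subset_flatDomain
  flatChart := d.flatChart
  isLateChart_flat := d.isLateChart_flat
  tendsto_deviationCk_flat :=
    tendsto_of_tendsto_of_tendsto_of_le_of_le tendsto_const_nhds d.tendsto_deviationCk_flat
      (fun _ ↦ zero_le) fun _ ↦ supCkENorm_mono_right _ h _
  diff_subset_causalPast := d.diff_subset_causalPast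

/-- Lowering the differentiability order does not change the charted late region. [folklore] -/
@[simp]
theorem charted_ofLE {k k' : ℕ} (d : FinalStateDecomposition 𝓢 𝒟 k') (h : k ≤ k') :
    (d.ofLE h).charted = d.charted :=
  rfl

end FinalStateDecomposition

/-! ### "Settles down to finitely many Kerr black holes plus radiation" -/

namespace Development

variable {X : Type u} [TopologicalSpace X] [ChartedSpace E3 X] [IsManifold (𝓡 3) ∞ X]
  [ConnectedSpace X] {D : InitialDataSet (𝓡 3) X}

/-- The **exterior region determined by a late charted set `U`** of the development
`𝒟 = (M, g, τ, ι, ν)`: `J⁺(ι X) ∩ I⁻(U)`, the events to the causal future of the data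
hypersurface from which a timelike signal reaches `U`. For `U` = the late image of a converging
asymptotic chart this is the `𝓘⁺`-free stand-in for `J⁻(𝓘⁺) ∩ J⁺(Σ)` used by
`Development.ExteriorConvergesTo` (interim `Sweep1`, gr.S05; Klainerman–Szeftel: "converges in
its causal past `J⁻(𝓘⁺)`", Dafermos–Luk Conjecture 1 (b)–(c): "black hole exterior region
`J⁻(𝓘⁺)`"). [cite: DafermosLuk2017, Conjecture 1] -/
def exteriorOf (𝒟 : Development D) (U : Set 𝒟.carrier) : Set 𝒟.carrier :=
  𝒟.metric.causalFuture 𝒟.timeOrientation (range 𝒟.embed) ∩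
    𝒟.metric.chronologicalPast 𝒟.timeOrientation U

/-- The exterior region determined by `U` lies to the causal future of the data hypersurface.
[folklore] -/
theorem exteriorOf_subset_causalFuture (𝒟 : Development D) (U : Set 𝒟.carrier) :
    𝒟.exteriorOf U ⊆ 𝒟.metric.causalFuture 𝒟.timeOrientation (range 𝒟.embed) :=
  inter_subset_left

/-- The exterior region determined by `U` lies in the chronological past of `U`. [folklore] -/
theorem exteriorOf_subset_chronologicalPast (𝒟 : Development D) (U : Set 𝒟.carrier) :
    𝒟.exteriorOf U ⊆ 𝒟.metric.chronologicalPast 𝒟.timeOrientation U :=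
  inter_subset_right

/-- The development `𝒟` **settles down, in `Cᵏ`, to finitely many Kerr black holes moving apart
plus radiation dispersing to Minkowski space** — clause (ii) of the final state conjecture
(Klainerman, C. R. Mécanique 353 (2025), §1.1.1: solutions "behave, in the large, like a finite
number of Kerr black holes plus a radiative decaying term"; Coley, GRG 51 (2019), p. 14: "either
disperses [...] or else eventually asymptotes (in the exterior) to finitely many Kerr solutions
[...] moving away from each other"; Dafermos–Luk, arXiv:1710.01722, §1.3.1; Penrose 1982,
Problem 12): there are a region `𝒟oc` and an `N`-black-hole final state decomposition `d` of
`𝒟oc` in `Cᵏ` (`FinalStateDecomposition`: `N` late charts on boosted, translated Kerr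
exteriors `g_{Mᵢ,aᵢ}`, `0 < Mᵢ`, `|aᵢ| ≤ Mᵢ`, converging in `Cᵏ` on every near zone,
pairwise separating; a flat late chart on the late half-space minus sublinear tubes around the
holes, converging in `Cᵏ` to `η`; global covering clause) such that `𝒟oc` **is** the exterior
region determined by the charts of `d` themselves, `𝒟oc = J⁺(ι X) ∩ I⁻(d.charted)`
(`Development.exteriorOf`; module docstring, design note (c)). Unfolded, the covering clause then
reads: every event to the future of the data hypersurface which can send a timelike signal into
the charted, converging late region is itself charted or lies in the causal past of the images
of the initial slabs `{t = τ₀}` — the charts exhaust the black-hole exterior down to the event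
horizons; nothing is asserted about black-hole interiors (Dafermos–Luk, p. 10). `N = 0` is
dispersal. Consequence-form paraphrase (no gauge, no rates), as everywhere in `KerrConvergence`.
[cite: Klainerman2025, §1.1.1] [cite: Coley2019, p. 14] [cite: DafermosLuk2017, §1.3.1]
[cite: Penrose1982, Problem 12] -/
def SettlesToKerrFamily (𝒟 : Development D) (k : ℕ) : Prop :=
  ∃ (𝒟oc : Set 𝒟.carrier) (d : FinalStateDecomposition 𝒟.toSpacetime 𝒟oc k),
    𝒟oc = 𝒟.exteriorOf d.charted

/-- Unfolding lemma for `SettlesToKerrFamily`. [folklore] -/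
theorem settlesToKerrFamily_iff (𝒟 : Development D) (k : ℕ) :
    𝒟.SettlesToKerrFamily k ↔
      ∃ (𝒟oc : Set 𝒟.carrier) (d : FinalStateDecomposition 𝒟.toSpacetime 𝒟oc k),
        𝒟oc = 𝒟.exteriorOf d.charted :=
  Iff.rfl

/-- Settling down in `Cᵏ'` implies settling down in `Cᵏ` for `k ≤ k'` (same charts, same
region: `FinalStateDecomposition.ofLE`, `charted_ofLE`). DHRT arXiv:2104.08222, §1. [cite: arXiv210408222, §1] -/
theorem SettlesToKerrFamily.of_le {𝒟 : Development D} {k k' : ℕ} (h : 𝒟.SettlesToKerrFamily k')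
    (hk : k ≤ k') : 𝒟.SettlesToKerrFamily k := by
  obtain ⟨𝒟oc, d, hd⟩ := h
  exact ⟨𝒟oc, d.ofLE hk, by rw [FinalStateDecomposition.charted_ofLE]; exact hd⟩

/-- A development which settles down to Kerr black holes carries, on its self-determined
exterior region, a final state decomposition in the region-parametrised sense of
`KerrConvergence` (the interim gr.S01 conclusion `∃ 𝒟oc, Nonempty (FinalStateDecomposition …)`).
Klainerman, C. R. Mécanique 353 (2025), §1.1.1. [cite: Klainerman2025, §1.1.1] -/
theorem SettlesToKerrFamily.exists_nonempty {𝒟 : Development D} {k : ℕ}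
    (h : 𝒟.SettlesToKerrFamily k) :
    ∃ 𝒟oc : Set 𝒟.carrier, Nonempty (FinalStateDecomposition 𝒟.toSpacetime 𝒟oc k) := by
  obtain ⟨𝒟oc, d, -⟩ := h
  exact ⟨𝒟oc, ⟨d⟩⟩

/-- In a development which settles down to Kerr black holes, the region carrying the
decomposition lies to the causal future of the data hypersurface (no statement is made about
the past development). Dafermos–Luk, arXiv:1710.01722, Conjecture 1. [cite: DafermosLuk2017, Conjecture 1] -/
theorem SettlesToKerrFamily.exists_subset_causalFuture {𝒟 : Development D} {k : ℕ}
    (h : 𝒟.SettlesToKerrFamily k) :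
    ∃ (𝒟oc : Set 𝒟.carrier) (d : FinalStateDecomposition 𝒟.toSpacetime 𝒟oc k),
      d.charted ⊆ 𝒟oc ∧ 𝒟oc ⊆ 𝒟.metric.causalFuture 𝒟.timeOrientation (range 𝒟.embed) := by
  obtain ⟨𝒟oc, d, hd⟩ := h
  exact ⟨𝒟oc, d, d.charted_subset, hd ▸ 𝒟.exteriorOf_subset_causalFuture _⟩

end Development

end Literature.Geometry.Lorentzian

end
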